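import Summits.NavierStokesRegularity.FunctionalMining.PalinstrophyWitnessField
import Summits.NavierStokesRegularity.FunctionalMining.QuadraticBudgetWitness
import Mathlib.Analysis.Calculus.BumpFunction.Normed
import HarnessLib

/-!
# Functional mining: a compactly supported divergence-free field on `ℝ³` with non-zero
# bi-Laplacian production `∫⟪(U·∇)U, Δ²U⟫` (no-go branch, palinstrophy rows)

Search for candidate a priori estimates; no regularity claim.

Cell `pub-nsfunc` (host summit NavierStokesRegularity, topic `FunctionalMining`), NO-GO branch,
palinstrophy rows (D7). Twin of `QuadraticBudgetWitness.lean` one Laplacian higher: the seed of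
the concentrating family for `𝒫 = ½‖Δu‖₂²` is a smooth, compactly supported, divergence-free `U`
on `ℝ³` with `σ₂(U) = ∫⟪(U·∇)U, Δ²U⟫ ≠ 0` (the inertial rate of `𝒫` is `−σ₂`,
`PalinstrophyRates.lean`). The SIGN is forced without evaluating any bump integral:
* `production2_add_smul`, `exists_production2_ne_zero` — `σ₂(V + εW)` is a real cubic in `ε`;
  a non-zero linear coefficient forces `σ₂ ≠ 0` at some `ε ∈ {0, 1, −1, 2}`;
* `linearCoeff2_eq` — for `V` equal to the cubic field `vP` of `PalinstrophyWitnessField` on the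
  unit ball (`Δ²vP = 0`) and `W = curl(β e₀)`: the coefficient is
  `∫⟪Δ²((V·∇)V), W⟫ = ∫ β ⟪curl Δ² nP, e₀⟫ = ∫ β · Δ²(−5y₂⁴) = −120 ∫β` (Green twice, curl
  integration by parts, `curl Δ = Δ curl` twice);
* `exists_compactSupport_divFree_production2_neg` — some `U = ± curl(χ potP + ε β e₀)` is smooth,
  supported in `B̄(0, 2)`, divergence free, with `σ₂(U) < 0` (positive inertial palinstrophy rate).
No definitions.
-/

noncomputable section

open MeasureTheory Set Filter Topology InnerProductSpace Metric
open scoped RealInnerProductSpace Laplacian ContDiff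

namespace Summit.NavierStokesRegularity.FunctionalMining

open Literature.Analysis.FluidPDE

namespace BumpWitness

/-! ## The bi-Laplacian production `σ₂(U) = ∫⟪(U·∇)U, Δ²U⟫` along a line `V + εW` -/

/-- The bi-Laplacian of a smooth compactly supported field is smooth and compactly supported.
[folklore] -/
theorem biLaplacian_smooth_compact {Z : EuclideanSpace ℝ (Fin 3) → EuclideanSpace ℝ (Fin 3)}
    (hZ : ContDiff ℝ ∞ Z) (hZc : HasCompactSupport Z) :
    ContDiff ℝ ∞ (Δ (Δ Z)) ∧ HasCompactSupport (Δ (Δ Z)) :=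
  ⟨contDiff_laplacian_of_smooth (contDiff_laplacian_of_smooth hZ),
    hasCompactSupport_laplacian (hasCompactSupport_laplacian hZc)⟩

/-- `y ↦ ⟪DX(y)(Y y), Δ²Z(y)⟫` is integrable for smooth `X, Z`, continuous `Y`, `Z` compactly
supported. [folklore] -/
theorem integrable_inner_fderiv_biLaplacian {X Y Z : EuclideanSpace ℝ (Fin 3) → EuclideanSpace ℝ (Fin 3)}
    (hX : ContDiff ℝ ∞ X) (hY : Continuous Y) (hZ : ContDiff ℝ ∞ Z) (hZc : HasCompactSupport Z) :
    Integrable (fun y => ⟪fderiv ℝ X y (Y y), Δ (Δ Z) y⟫)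
      (volume : Measure (EuclideanSpace ℝ (Fin 3))) :=
  integrable_inner_of_hasCompactSupport_right ((hX.continuous_fderiv (by simp)).clm_apply hY)
    (biLaplacian_smooth_compact hZ hZc).1.continuous (biLaplacian_smooth_compact hZ hZc).2

variable {V W : EuclideanSpace ℝ (Fin 3) → EuclideanSpace ℝ (Fin 3)}

/-- `Δ²(V + εW) = Δ²V + ε Δ²W` for smooth fields. [folklore] -/
theorem biLaplacian_add_smul (hV : ContDiff ℝ ∞ V) (hW : ContDiff ℝ ∞ W) (ε : ℝ)
    (y : EuclideanSpace ℝ (Fin 3)) :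
    Δ (Δ (fun z => V z + ε • W z)) y = Δ (Δ V) y + ε • Δ (Δ W) y := by
  have hW' : ContDiff ℝ ∞ (ε • W) := hW.const_smul ε
  have hV2 : ContDiff ℝ 2 V := hV.of_le (WithTop.coe_le_coe.mpr le_top)
  have hW2 : ContDiff ℝ 2 W := hW.of_le (WithTop.coe_le_coe.mpr le_top)
  have hW2' : ContDiff ℝ 2 (ε • W) := hW2.const_smul ε
  have h1 : Δ (fun z => V z + ε • W z) = Δ V + ε • Δ W := by
    funext z
    rw [show (fun z => V z + ε • W z) = V + ε • W from rfl,
      hV2.contDiffAt.laplacian_add hW2'.contDiffAt, laplacian_smul ε hW2.contDiffAt]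
    rfl
  have hΔV : ContDiff ℝ 2 (Δ V) := (contDiff_laplacian_of_smooth hV).of_le (WithTop.coe_le_coe.mpr le_top)
  have hΔW : ContDiff ℝ 2 (Δ W) := (contDiff_laplacian_of_smooth hW).of_le (WithTop.coe_le_coe.mpr le_top)
  have hΔW' : ContDiff ℝ 2 (ε • Δ W) := hΔW.const_smul ε
  rw [h1, hΔV.contDiffAt.laplacian_add hΔW'.contDiffAt, laplacian_smul ε hΔW.contDiffAt]

/-- **Cubic expansion of `σ₂` along a line**: for smooth compactly supported `V, W` and real `ε`,
`σ₂(V + εW) = σ₂(V) + ε A₁ + ε² A₂ + ε³ σ₂(W)` with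
`A₁ = ∫ (⟪(W·∇)V, Δ²V⟫ + ⟪(V·∇)W, Δ²V⟫ + ⟪(V·∇)V, Δ²W⟫)`. [folklore] -/
theorem production2_add_smul (hV : ContDiff ℝ ∞ V) (hVc : HasCompactSupport V) (hW : ContDiff ℝ ∞ W)
    (hWc : HasCompactSupport W) (ε : ℝ) :
    (∫ y, ⟪fderiv ℝ (fun z => V z + ε • W z) y (V y + ε • W y), Δ (Δ (fun z => V z + ε • W z)) y⟫) =
      (∫ y, ⟪fderiv ℝ V y (V y), Δ (Δ V) y⟫) +
        ε * (∫ y, (⟪fderiv ℝ V y (W y), Δ (Δ V) y⟫ + ⟪fderiv ℝ W y (V y), Δ (Δ V) y⟫ +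
          ⟪fderiv ℝ V y (V y), Δ (Δ W) y⟫)) +
        ε ^ 2 * (∫ y, (⟪fderiv ℝ W y (W y), Δ (Δ V) y⟫ + ⟪fderiv ℝ W y (V y), Δ (Δ W) y⟫ +
          ⟪fderiv ℝ V y (W y), Δ (Δ W) y⟫)) +
        ε ^ 3 * ∫ y, ⟪fderiv ℝ W y (W y), Δ (Δ W) y⟫ := by
  have hVd : ∀ y, DifferentiableAt ℝ V y := fun y => (hV.differentiable (by simp)) y
  have hWd : ∀ y, DifferentiableAt ℝ W y := fun y => (hW.differentiable (by simp)) y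
  have hpt : ∀ y,
      ⟪fderiv ℝ (fun z => V z + ε • W z) y (V y + ε • W y), Δ (Δ (fun z => V z + ε • W z)) y⟫ =
      ⟪fderiv ℝ V y (V y), Δ (Δ V) y⟫ +
        ε * (⟪fderiv ℝ V y (W y), Δ (Δ V) y⟫ + ⟪fderiv ℝ W y (V y), Δ (Δ V) y⟫ +
          ⟪fderiv ℝ V y (V y), Δ (Δ W) y⟫) +
        ε ^ 2 * (⟪fderiv ℝ W y (W y), Δ (Δ V) y⟫ + ⟪fderiv ℝ W y (V y), Δ (Δ W) y⟫ +
          ⟪fderiv ℝ V y (W y), Δ (Δ W) y⟫) +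
        ε ^ 3 * ⟪fderiv ℝ W y (W y), Δ (Δ W) y⟫ := by
    intro y
    have hD : fderiv ℝ (fun z => V z + ε • W z) y = fderiv ℝ V y + ε • fderiv ℝ W y := by
      have hW' : DifferentiableAt ℝ (fun z => ε • W z) y := (hWd y).const_smul ε
      rw [fderiv_fun_add (hVd y) hW', fderiv_fun_const_smul (hWd y)]
    rw [hD, biLaplacian_add_smul hV hW ε y]
    simp only [add_apply, smul_apply, map_add, map_smul, inner_add_left, inner_add_right,
      real_inner_smul_left, real_inner_smul_right]
    ring
  have i0 := integrable_inner_fderiv_biLaplacian hV hV.continuous hV hVc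
  have i1a := integrable_inner_fderiv_biLaplacian hV hW.continuous hV hVc
  have i1b := integrable_inner_fderiv_biLaplacian hW hV.continuous hV hVc
  have i1c := integrable_inner_fderiv_biLaplacian hV hV.continuous hW hWc
  have i2a := integrable_inner_fderiv_biLaplacian hW hW.continuous hV hVc
  have i2b := integrable_inner_fderiv_biLaplacian hW hV.continuous hW hWc
  have i2c := integrable_inner_fderiv_biLaplacian hV hW.continuous hW hWc
  have i3 := integrable_inner_fderiv_biLaplacian hW hW.continuous hW hWc
  rw [integral_congr_ae (ae_of_all _ hpt)]
  exact integral_cubic_poly i0 ((i1a.add i1b).add i1c) ((i2a.add i2b).add i2c) i3 ε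

/-- A non-zero linear coefficient forces `σ₂(V + εW) ≠ 0` for some `ε ∈ {0, 1, −1, 2}`. [folklore] -/
theorem exists_production2_ne_zero (hV : ContDiff ℝ ∞ V) (hVc : HasCompactSupport V)
    (hW : ContDiff ℝ ∞ W) (hWc : HasCompactSupport W)
    (hA : (∫ y, (⟪fderiv ℝ V y (W y), Δ (Δ V) y⟫ + ⟪fderiv ℝ W y (V y), Δ (Δ V) y⟫ +
          ⟪fderiv ℝ V y (V y), Δ (Δ W) y⟫)) ≠ 0) :
    ∃ ε : ℝ, (∫ y, ⟪fderiv ℝ (fun z => V z + ε • W z) y (V y + ε • W y),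
      Δ (Δ (fun z => V z + ε • W z)) y⟫) ≠ 0 := by
  by_contra h
  push Not at h
  have h0 := h 0
  have h1 := h 1
  have hm := h (-1)
  have h2 := h 2
  rw [production2_add_smul hV hVc hW hWc] at h0 h1 hm h2
  norm_num at h0 h1 hm h2
  apply hA
  linarith

/-! ## The linear coefficient along a bump perturbation of the planted cubic field -/

/-- **The linear coefficient is `−120 ∫β`.** Let `V ∈ C^∞_c(ℝ³; ℝ³)` coincide with the cubic
field `vP` on the unit ball (`Δ²vP = 0`), and `W = curl(β e₀)` with `β ∈ C^∞_c` supported in the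
unit ball. Then `∫ (⟪(W·∇)V, Δ²V⟫ + ⟪(V·∇)W, Δ²V⟫ + ⟪(V·∇)V, Δ²W⟫) = −120 ∫β`: the first two
integrands vanish identically, and
`∫⟪(V·∇)V, Δ²W⟫ = ∫⟪Δ²((V·∇)V), W⟫ = ∫ β ⟪curl Δ² nP, e₀⟫ = ∫ β · Δ²(−5y₂⁴) = −120 ∫β`
(Green twice, curl integration by parts, `curl Δ = Δ curl` twice, `PalinstrophyWitnessField`).
[folklore] -/
theorem linearCoeff2_eq {β : EuclideanSpace ℝ (Fin 3) → ℝ}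
    (hV : ContDiff ℝ ∞ V) (hVc : HasCompactSupport V)
    (hVq : ∀ y ∈ Metric.ball (0 : EuclideanSpace ℝ (Fin 3)) 1, V y = vP y)
    (hβ : ContDiff ℝ ∞ β) (hβc : HasCompactSupport β)
    (hβs : tsupport β ⊆ Metric.ball (0 : EuclideanSpace ℝ (Fin 3)) 1)
    (hW : W = curl fun y => β y • e 0) :
    (∫ y, (⟪fderiv ℝ V y (W y), Δ (Δ V) y⟫ + ⟪fderiv ℝ W y (V y), Δ (Δ V) y⟫ +
        ⟪fderiv ℝ V y (V y), Δ (Δ W) y⟫)) = -120 * ∫ y, β y := by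
  set Ψ : EuclideanSpace ℝ (Fin 3) → EuclideanSpace ℝ (Fin 3) := fun y => β y • e 0 with hΨdef
  have hΨ : ContDiff ℝ ∞ Ψ := hβ.smul contDiff_const
  have hΨsupp : tsupport Ψ ⊆ tsupport β :=
    closure_mono fun y hy => by
      contrapose! hy
      simp [hΨdef, Function.notMem_support.1 hy]
  have hΨc : HasCompactSupport Ψ := hβc.mono' (subset_closure.trans hΨsupp)
  have hΨ1 : ContDiff ℝ 1 Ψ := hΨ.of_le (WithTop.coe_le_coe.mpr le_top)
  have hWs : ContDiff ℝ ∞ W := hW ▸ contDiff_curl (n := ⊤) (hΨ.of_le (by exact_mod_cast le_top))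
  have hWc : HasCompactSupport W := hW ▸ hasCompactSupport_curl hΨc
  have hW0 : ∀ y, y ∉ tsupport β → W y = 0 := fun y hy => by
    rw [hW]; exact curl_eq_zero_of_notMem_tsupport fun h => hy (hΨsupp h)
  have hWsupp : tsupport W ⊆ tsupport β :=
    closure_minimal (fun y hy => by by_contra h; exact hy (hW0 y h)) (isClosed_tsupport β)
  have hDW0 : ∀ y, y ∉ tsupport β → fderiv ℝ W y = 0 := fun y hy =>
    fderiv_of_notMem_tsupport ℝ fun h => hy (hWsupp h)
  -- `V = vP` near every point of the unit ball: `Δ²V = 0` there, `(V·∇)V = nP` there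
  have hVq' : ∀ y ∈ Metric.ball (0 : EuclideanSpace ℝ (Fin 3)) 1, V =ᶠ[𝓝 y] vP := fun y hy =>
    Filter.eventuallyEq_of_mem (Metric.isOpen_ball.mem_nhds hy) hVq
  have hΔV : ∀ y ∈ Metric.ball (0 : EuclideanSpace ℝ (Fin 3)) 1, Δ V y = Δ vP y := fun y hy =>
    (laplacian_congr_nhds (hVq' y hy)).eq_of_nhds
  have hΔV' : ∀ y ∈ Metric.ball (0 : EuclideanSpace ℝ (Fin 3)) 1, Δ V =ᶠ[𝓝 y] Δ vP := fun y hy =>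
    Filter.eventuallyEq_of_mem (Metric.isOpen_ball.mem_nhds hy) hΔV
  have hΔΔV : ∀ y ∈ Metric.ball (0 : EuclideanSpace ℝ (Fin 3)) 1, Δ (Δ V) y = 0 := fun y hy => by
    rw [(laplacian_congr_nhds (hΔV' y hy)).eq_of_nhds, laplacian_laplacian_vP]
  set N : EuclideanSpace ℝ (Fin 3) → EuclideanSpace ℝ (Fin 3) := fun y => fderiv ℝ V y (V y)
    with hNdef
  have hN : ContDiff ℝ ∞ N := (hV.fderiv_right (m := ∞) le_rfl).clm_apply hV
  have hNc : HasCompactSupport N := hVc.mono fun y hy => by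
    contrapose! hy
    simp [hNdef, Function.notMem_support.1 hy]
  have hNq : ∀ y ∈ Metric.ball (0 : EuclideanSpace ℝ (Fin 3)) 1, N y = nP y := fun y hy => by
    simp only [hNdef]
    rw [(hVq' y hy).fderiv_eq, hVq y hy, convect_vP]
  have hNq' : ∀ y ∈ Metric.ball (0 : EuclideanSpace ℝ (Fin 3)) 1, N =ᶠ[𝓝 y] nP := fun y hy =>
    Filter.eventuallyEq_of_mem (Metric.isOpen_ball.mem_nhds hy) hNq
  -- the first two integrands vanish identically
  have hT1 : ∀ y, ⟪fderiv ℝ V y (W y), Δ (Δ V) y⟫ = 0 := fun y => by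
    by_cases hy : y ∈ Metric.ball (0 : EuclideanSpace ℝ (Fin 3)) 1
    · rw [hΔΔV y hy, inner_zero_right]
    · rw [hW0 y fun h => hy (hβs h), map_zero, inner_zero_left]
  have hT2 : ∀ y, ⟪fderiv ℝ W y (V y), Δ (Δ V) y⟫ = 0 := fun y => by
    by_cases hy : y ∈ Metric.ball (0 : EuclideanSpace ℝ (Fin 3)) 1
    · rw [hΔΔV y hy, inner_zero_right]
    · rw [hDW0 y fun h => hy (hβs h)]
      simp
  -- the third: Green twice, curl integration by parts, `curl Δ = Δ curl` twice
  have hT3 : (∫ y, ⟪fderiv ℝ V y (V y), Δ (Δ W) y⟫) = -120 * ∫ y, β y := by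
    have hΔN : ContDiff ℝ ∞ (Δ N) := contDiff_laplacian_of_smooth hN
    have hΔΔN : ContDiff ℝ ∞ (Δ (Δ N)) := contDiff_laplacian_of_smooth hΔN
    have hΔW : ContDiff ℝ ∞ (Δ W) := contDiff_laplacian_of_smooth hWs
    have ha : (∫ y, ⟪N y, Δ (Δ W) y⟫) = ∫ y, ⟪Δ (Δ N) y, W y⟫ := by
      rw [← integral_inner_laplacian_comm (hN.of_le (WithTop.coe_le_coe.mpr le_top))
        (hΔW.of_le (WithTop.coe_le_coe.mpr le_top)) (hasCompactSupport_laplacian hWc),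
        ← integral_inner_laplacian_comm (hΔN.of_le (WithTop.coe_le_coe.mpr le_top))
        (hWs.of_le (WithTop.coe_le_coe.mpr le_top)) hWc]
    have hb : (∫ y, ⟪Δ (Δ N) y, W y⟫) = ∫ y, ⟪curl (Δ (Δ N)) y, Ψ y⟫ := by
      rw [hW]
      exact (integral_inner_curl_eq_integral_inner_curl
        (hΔΔN.of_le (WithTop.coe_le_coe.mpr le_top)) hΨ1 hΨc).symm
    -- `curl Δ² N = Δ² (curl N)` componentwise, and locally `curl N · e₀ = −5y₂⁴`
    have hcurlΔ : ∀ (Z : EuclideanSpace ℝ (Fin 3) → EuclideanSpace ℝ (Fin 3)), ContDiff ℝ ∞ Z →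
        (fun z => curl (Δ Z) z 0) = Δ (fun z => curl Z z 0) := fun Z hZ => by
      funext z
      rw [curl_laplacian (hZ.of_le (WithTop.coe_le_coe.mpr le_top)) z]
      have hcd : ContDiffAt ℝ 2 (curl Z) z :=
        (contDiff_curl (n := 2) (hZ.of_le (WithTop.coe_le_coe.mpr le_top))).contDiffAt
      exact (hcd.laplacian_CLM_comp_left (l := (EuclideanSpace.proj 0 :
        EuclideanSpace ℝ (Fin 3) →L[ℝ] ℝ))).symm
    have hq : ∀ z ∈ Metric.ball (0 : EuclideanSpace ℝ (Fin 3)) 1,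
        Δ (fun z => curl N z 0) z = Δ (fun z : EuclideanSpace ℝ (Fin 3) => (-5 * z 2 ^ 4 : ℝ)) z :=
      fun z hz => by
      refine (laplacian_congr_nhds ?_).eq_of_nhds
      filter_upwards [Metric.isOpen_ball.mem_nhds hz] with z' hz'
      rw [curl_eq_curlCLM, (hNq' z' hz').fderiv_eq, ← curl_eq_curlCLM, curl_nP_zero]
    have hc : ∀ y, ⟪curl (Δ (Δ N)) y, Ψ y⟫ = -120 * β y := fun y => by
      have hinner : ⟪curl (Δ (Δ N)) y, Ψ y⟫ = β y * curl (Δ (Δ N)) y 0 := by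
        simp [hΨdef, e, real_inner_smul_right, EuclideanSpace.inner_single_right]
      rw [hinner]
      by_cases hy : y ∈ tsupport β
      · have hyb : y ∈ Metric.ball (0 : EuclideanSpace ℝ (Fin 3)) 1 := hβs hy
        have h1 : curl (Δ (Δ N)) y 0 = Δ (Δ (fun z => curl N z 0)) y := by
          rw [show curl (Δ (Δ N)) y 0 = (fun z => curl (Δ (Δ N)) z 0) y from rfl, hcurlΔ _ hΔN,
            hcurlΔ _ hN]
        have h2 : Δ (fun z => curl N z 0) =ᶠ[𝓝 y]
            Δ (fun z : EuclideanSpace ℝ (Fin 3) => (-5 * z 2 ^ 4 : ℝ)) :=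
          Filter.eventuallyEq_of_mem (Metric.isOpen_ball.mem_nhds hyb) hq
        rw [h1, (laplacian_congr_nhds h2).eq_of_nhds, laplacian_curl_nP_zero,
          laplacian_laplacian_curl_nP_zero]
        ring
      · simp [image_eq_zero_of_notMem_tsupport hy]
    rw [ha, hb, integral_congr_ae (ae_of_all _ hc), integral_const_mul]
  have hsum : ∀ y, ⟪fderiv ℝ V y (W y), Δ (Δ V) y⟫ + ⟪fderiv ℝ W y (V y), Δ (Δ V) y⟫ +
      ⟪fderiv ℝ V y (V y), Δ (Δ W) y⟫ = ⟪fderiv ℝ V y (V y), Δ (Δ W) y⟫ := fun y => by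
    rw [hT1 y, hT2 y, zero_add, zero_add]
  rw [integral_congr_ae (ae_of_all _ hsum), hT3]

/-! ## The seed: a compactly supported divergence-free field with `σ₂ < 0` -/

/-- `σ₂(−U) = −σ₂(U)`. [folklore] -/
theorem production2_neg (U : EuclideanSpace ℝ (Fin 3) → EuclideanSpace ℝ (Fin 3)) :
    (∫ y, ⟪fderiv ℝ (fun z => -U z) y (-U y), Δ (Δ (fun z => -U z)) y⟫) =
      -∫ y, ⟪fderiv ℝ U y (U y), Δ (Δ U) y⟫ := by
  rw [← integral_neg]
  refine integral_congr_ae (ae_of_all _ fun y => ?_)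
  dsimp only
  have h1 : Δ (-U) = -Δ U := by
    funext z; rw [laplacian_neg, Pi.neg_apply]
  rw [show (fun z => -U z) = -U from rfl, fderiv_neg, h1, laplacian_neg]
  simp [inner_neg_right]

/-- **The planted-bump seed for the palinstrophy rows, for given bumps.** [folklore] -/
theorem exists_production2_neg_of_bumps (χ β : ContDiffBump (0 : EuclideanSpace ℝ (Fin 3)))
    (hχ1 : χ.rIn = 1) (hχ2 : χ.rOut = 2) (hβ2 : β.rOut = 2⁻¹) :
    ∃ U : EuclideanSpace ℝ (Fin 3) → EuclideanSpace ℝ (Fin 3), ContDiff ℝ ∞ U ∧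
      tsupport U ⊆ Metric.closedBall 0 2 ∧ (∀ y, VectorCalculus.divergence U y = 0) ∧
      (∫ y, ⟪fderiv ℝ U y (U y), Δ (Δ U) y⟫) < 0 := by
  obtain ⟨P, hPdef⟩ : ∃ P : EuclideanSpace ℝ (Fin 3) → EuclideanSpace ℝ (Fin 3),
      P = fun y => (χ : EuclideanSpace ℝ (Fin 3) → ℝ) y • potP y := ⟨_, rfl⟩
  obtain ⟨Ψ, hΨdef⟩ : ∃ Ψ : EuclideanSpace ℝ (Fin 3) → EuclideanSpace ℝ (Fin 3),
      Ψ = fun y => (β : EuclideanSpace ℝ (Fin 3) → ℝ) y • e 0 := ⟨_, rfl⟩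
  have hP : ContDiff ℝ ∞ P := hPdef ▸ χ.contDiff.smul contDiff_potP
  have hΨ : ContDiff ℝ ∞ Ψ := hΨdef ▸ β.contDiff.smul contDiff_const
  have hPd : ∀ y, DifferentiableAt ℝ P y := fun y => (hP.differentiable (by simp)) y
  have hΨd : ∀ y, DifferentiableAt ℝ Ψ y := fun y => (hΨ.differentiable (by simp)) y
  have hP0 : ∀ y, (χ : EuclideanSpace ℝ (Fin 3) → ℝ) y = 0 → P y = 0 := fun y hy => by
    rw [hPdef]; simp [hy]
  have hΨ0 : ∀ y, (β : EuclideanSpace ℝ (Fin 3) → ℝ) y = 0 → Ψ y = 0 := fun y hy => by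
    rw [hΨdef]; simp [hy]
  have hPc : HasCompactSupport P := χ.hasCompactSupport.mono fun y hy => by
    contrapose! hy
    exact Function.notMem_support.2 (hP0 y (Function.notMem_support.1 hy))
  have hΨc : HasCompactSupport Ψ := β.hasCompactSupport.mono fun y hy => by
    contrapose! hy
    exact Function.notMem_support.2 (hΨ0 y (Function.notMem_support.1 hy))
  have hβsupp : tsupport (β : EuclideanSpace ℝ (Fin 3) → ℝ) ⊆
      Metric.ball (0 : EuclideanSpace ℝ (Fin 3)) 1 := by
    rw [β.tsupport_eq, hβ2]
    exact Metric.closedBall_subset_ball (by norm_num)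
  have hV : ContDiff ℝ ∞ (curl P) := contDiff_curl (n := ⊤) (hP.of_le (by exact_mod_cast le_top))
  have hW : ContDiff ℝ ∞ (curl Ψ) := contDiff_curl (n := ⊤) (hΨ.of_le (by exact_mod_cast le_top))
  have hVc : HasCompactSupport (curl P) := hasCompactSupport_curl hPc
  have hWc : HasCompactSupport (curl Ψ) := hasCompactSupport_curl hΨc
  have hVq : ∀ y ∈ Metric.ball (0 : EuclideanSpace ℝ (Fin 3)) 1, curl P y = vP y := fun y hy => by
    have h1 : (χ : EuclideanSpace ℝ (Fin 3) → ℝ) =ᶠ[𝓝 y] 1 :=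
      χ.eventuallyEq_one_of_mem_ball (by rw [hχ1]; exact hy)
    have h2 : P =ᶠ[𝓝 y] potP := by
      filter_upwards [h1] with z hz
      rw [hPdef]
      simp [hz]
    rw [curl_eq_curlCLM, h2.fderiv_eq, ← curl_eq_curlCLM, curl_potP]
  have hA := linearCoeff2_eq (W := curl Ψ) hV hVc hVq β.contDiff β.hasCompactSupport hβsupp
    (by rw [hΨdef])
  have hβpos : 0 < ∫ y, (β : EuclideanSpace ℝ (Fin 3) → ℝ) y := β.integral_pos
  have hA' : (∫ y, (⟪fderiv ℝ (curl P) y (curl Ψ y), Δ (Δ (curl P)) y⟫ +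
      ⟪fderiv ℝ (curl Ψ) y (curl P y), Δ (Δ (curl P)) y⟫ +
        ⟪fderiv ℝ (curl P) y (curl P y), Δ (Δ (curl Ψ)) y⟫)) ≠ 0 := by
    rw [hA]; linarith
  obtain ⟨ε, hε⟩ := exists_production2_ne_zero hV hVc hW hWc hA'
  obtain ⟨Φ, hΦdef⟩ : ∃ Φ : EuclideanSpace ℝ (Fin 3) → EuclideanSpace ℝ (Fin 3),
      Φ = fun y => P y + ε • Ψ y := ⟨_, rfl⟩
  have hΦ : ContDiff ℝ ∞ Φ := hΦdef ▸ hP.add (hΨ.const_smul ε)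
  have hcurlΦ : curl Φ = fun y => curl P y + ε • curl Ψ y := by
    funext y
    have hΨ' : DifferentiableAt ℝ (fun z => ε • Ψ z) y := (hΨd y).const_smul ε
    rw [hΦdef, curl_add (hPd y) hΨ', curl_const_smul (hΨd y)]
  have hΦsupp : tsupport Φ ⊆ Metric.closedBall (0 : EuclideanSpace ℝ (Fin 3)) 2 := by
    have h1 : Function.support Φ ⊆ Metric.ball 0 2 := fun y hy => by
      by_contra hy'
      have hχ0 : (χ : EuclideanSpace ℝ (Fin 3) → ℝ) y = 0 := by
        apply Function.notMem_support.1
        rw [χ.support_eq, hχ2]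
        exact hy'
      have hβ0 : (β : EuclideanSpace ℝ (Fin 3) → ℝ) y = 0 := by
        apply Function.notMem_support.1
        rw [β.support_eq, hβ2]
        exact fun h => hy' (Metric.ball_subset_ball (by norm_num) h)
      refine hy ?_
      rw [hΦdef]
      simp only [hP0 y hχ0, hΨ0 y hβ0, smul_zero, add_zero]
    calc tsupport Φ = closure (Function.support Φ) := rfl
      _ ⊆ closure (Metric.ball 0 2) := closure_mono h1
      _ = Metric.closedBall 0 2 := closure_ball 0 two_ne_zero
  have key : ∀ Φ' : EuclideanSpace ℝ (Fin 3) → EuclideanSpace ℝ (Fin 3), ContDiff ℝ ∞ Φ' →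
      tsupport Φ' ⊆ Metric.closedBall 0 2 →
      ContDiff ℝ ∞ (curl Φ') ∧ tsupport (curl Φ') ⊆ Metric.closedBall 0 2 ∧
        ∀ y, VectorCalculus.divergence (curl Φ') y = 0 := fun Φ' hΦ' hs =>
    ⟨contDiff_curl (n := ⊤) (hΦ'.of_le (by exact_mod_cast le_top)),
      (closure_minimal (fun y hy => by by_contra h; exact hy (curl_eq_zero_of_notMem_tsupport h))
        (isClosed_tsupport Φ')).trans hs,
      fun y => divergence_curl_eq_zero_holds Φ' (hΦ'.of_le (WithTop.coe_le_coe.mpr le_top)) y⟩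
  rcases lt_or_gt_of_ne hε with hneg | hpos
  · obtain ⟨k1, k2, k3⟩ := key Φ hΦ hΦsupp
    exact ⟨curl Φ, k1, k2, k3, by rwa [hcurlΦ]⟩
  · have hnegsupp : tsupport (fun y => -Φ y) ⊆ Metric.closedBall (0 : EuclideanSpace ℝ (Fin 3)) 2 := by
      rw [show (fun y => -Φ y) = -Φ from rfl, tsupport_neg]
      exact hΦsupp
    obtain ⟨k1, k2, k3⟩ := key _ hΦ.neg hnegsupp
    refine ⟨curl fun y => -Φ y, k1, k2, k3, ?_⟩
    have h1 : (curl fun y => -Φ y) = fun y => -(curl Φ) y := funext fun y => curl_neg Φ y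
    rw [h1, production2_neg, hcurlΦ]
    linarith

/-- **The planted-bump seed for the palinstrophy rows.** There is a smooth divergence-free field
`U` on `ℝ³`, supported in `B̄(0, 2)`, with `∫⟪(U·∇)U, Δ²U⟫ < 0`, i.e. with POSITIVE inertial
palinstrophy rate `−∫⟪(U·∇)U, Δ²U⟫` (Mathlib bumps of radii `(1, 2)` and `(¼, ½)`; the sign comes
from `−120 ∫β ≠ 0`, no transcendental integral is evaluated). [folklore] -/
theorem exists_compactSupport_divFree_production2_neg :
    ∃ U : EuclideanSpace ℝ (Fin 3) → EuclideanSpace ℝ (Fin 3), ContDiff ℝ ∞ U ∧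
      tsupport U ⊆ Metric.closedBall 0 2 ∧ (∀ y, VectorCalculus.divergence U y = 0) ∧
      (∫ y, ⟪fderiv ℝ U y (U y), Δ (Δ U) y⟫) < 0 :=
  exists_production2_neg_of_bumps ⟨1, 2, one_pos, one_lt_two⟩
    ⟨4⁻¹, 2⁻¹, by norm_num, by norm_num⟩ rfl rfl rfl

end BumpWitness

end Summit.NavierStokesRegularity.FunctionalMining

end
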